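import Literature.MathematicalPhysics.QuantumFieldTheory.Balaban1983to89.B12Membership313IILie

/-!
# B12 [Balaban1987RG1] p. 272 / (1.13) p. 262, condition (ii), clause «A′ has values in the algebra 𝐠ᶜ» for
# `G = SU(N)` (`𝔤ᶜ = 𝔰𝔩(N, ℂ)`): an `N`-FREE radius — `tr log(e^X e^Y) = 0` for trace-free `X, Y` with
# `‖X‖ + ‖Y‖ ≤ 1/3`, by continuity along `t ↦ e^{tX}e^{tY}` (supplement to `B12Membership313IILie`)

WHY THIS FILE. The tree's log chart for `SL(N, ℂ)` (`specialLinearLogChart`, radius `ρ = min(1/3, 3/N)`) proves `tr log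
W = 0` for `det W = 1` from `|tr log W| ≤ N‖log W‖ < 2π`, which needs `N‖W − 1‖ < π`; through it the `SU(N)` instance
`B12Membership313IILie.trace_newPot_eq_zero_of_condII` of the (ii)-clause inherited the `N`-dependent restriction `2α₁ ≤
min(1/3, 3/N)` (DIVERGENCE D-b12g17.2, note (2): an artefact of that certificate, not of print — for `W = e^{2πi/N}·1`
one has `det W = 1`, `‖W − 1‖ = |e^{2πi/N} − 1| → 0` and `tr log W = 2πi`, so the chart radius itself cannot be
`N`-free; a remark, not formalised here). For PRODUCTS OF EXPONENTIALS of trace-free matrices no such restriction is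
needed: along the path `W_t = e^{tX}e^{tY}`, `t ∈ [0, 1]`, one has `det W_t = 1` and `‖W_t − 1‖ ≤ 2t(‖X‖ + ‖Y‖) ≤ 2/3 <
1`, so `t ↦ tr log W_t` is continuous with values in the discrete set `2πiℤ` (`e^{tr log W_t} = det e^{log W_t} = det
W_t = 1`), hence constant `= tr log W_0 = 0`. Consequently `A″ = newPot ξ 𝐀 A′ = (iξ)⁻¹ log(e^{iξ𝐀}e^{iξA′})` is
trace-free as soon as `ξ(‖𝐀‖ + ‖A′‖) ≤ 1/3`, and the `SU(N)` instance of the (ii)-clause holds under the companion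
transcription's restriction `8α₂ ≤ α₁ ≤ 1/16` ALONE (`trace_newPot_eq_zero_of_condII'`), uniformly in `N` — in line with
print's «α₂, depending on α₀ and on some absolute constants» (p. 272) for every `SU(N)` at once.

THE PRINT (as in the companion files).  B12 p. 262 [PDF 14]: *«(ii) U′ = exp iξA′, A′ has values in the algebra 𝐠ᶜ,
|A′|, |∇^ξ_U A′| < α₁ on X. (1.13)»*; p. 252 [PDF 4]: *«𝐠ᶜ is the complexification of the real Lie algebra 𝐠»*; p. 272
[PDF 24] (the two sentences before (3.14)): *«These restrictions can be easily obtained from the definition of the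
spaces, and from the form of the expressions in (3.13). Thus, there exists a constant α₂, depending on α₀ and on some
absolute constants, such that the function (3.13) is analytic in 𝐀, for 𝐀 satisfying the conditions |𝐀|, |P₁𝐀|,
|∇^ξ_𝐔𝐀|, |Δ^ξ_𝐔𝐀| < α₂ on X. (3.14)»* (the passage from (3.13) on is quoted in full in `B12Membership313II`).  Print
sets the Lie algebras in bold (`𝐠`, `𝐠ᶜ`); outside quotations this file writes `𝔤ᶜ`, as its companions do.
v1.1 (DOCFIX, docstrings only, code byte-identical to v1): v1 carried at this place, inside guillemets and attributed to
p. 272, the same non-verbatim sentence as `B12Membership313IILie` v1 (cross-read finding M1 there: it named "γ_2" and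
"the spaces (1.11)-(1.15)", which do not occur on p. 272) — replaced by the verbatim sentences; nothing depended on it.

CONTENTS.  §1 `det(e^X e^Y) = 1` for trace-free `X, Y`; `e^{tr log W} = det W` and `tr log W ∈ 2πiℤ` for `det W = 1`,
`‖W − 1‖ < 1`.  §2 `trace_mlog_exp_mul_exp_eq_zero` (the `N`-free statement, by `IsPreconnected.constant_of_mapsTo` on
`[0, 1]`), `bchLog_mem_specialLinear` (closure of `𝔰𝔩(N, ℂ)` under `log(e^X e^Y)` at radius `1/3`).  §3
`trace_newPot_eq_zero'`, `trace_newPot_eq_zero_of_condII'` (the `SU(N)` (ii)-clause, `N`-free).  Operator (`L²`) norm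
throughout (scope `Matrix.Norms.L2Operator`), as in the companion files.  Every theorem is [folklore] finite-dimensional
Lie theory except the last, which transcribes the (ii)-clause; nothing of [B12] is asserted; NOT summit progress.
-/

namespace Literature.MathematicalPhysics.QuantumFieldTheory.Balaban1983to89.B12Membership313IISL

open NormedSpace
open Literature.MathematicalPhysics.QuantumFieldTheory.Balaban1983to89
open Literature.MathematicalPhysics.QuantumFieldTheory.Balaban1983to89.B12Membership314 (norm_I_mul_smul)
open Literature.MathematicalPhysics.QuantumFieldTheory.Balaban1983to89.B12Membership313II (bchLog newPot)
open Literature.MathematicalPhysics.QuantumFieldTheory.Balaban1983to89.B12Membership313IILie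
open Literature.Analysis.Complex (logOnePlus continuousOn_logOnePlus_comp)
open Literature.Analysis.Matrix (det_exp_eq_exp_trace)
open Complex (I)
open scoped Matrix.Norms.L2Operator

variable {n : Type*} [Fintype n] [DecidableEq n]

/-! ## §1  Determinant one along products of exponentials of trace-free matrices -/

/-- `det(e^X e^Y) = e^{tr X}e^{tr Y} = 1` for trace-free `X, Y` (Liouville's formula). [folklore] -/
theorem det_exp_mul_exp_eq_one {X Y : Matrix n n ℂ} (hX : X.trace = 0) (hY : Y.trace = 0) :
    (exp X * exp Y).det = 1 := by
  rw [Matrix.det_mul, det_exp_eq_exp_trace, det_exp_eq_exp_trace, hX, hY, exp_zero, mul_one]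

/-- `e^{tr log W} = det W` for `‖W − 1‖ < 1` (`e^{tr log W} = det e^{log W}` and `e^{log W} = W`). [folklore] -/
theorem cexp_trace_mlog_eq_det {W : Matrix n n ℂ} (hW : ‖W - 1‖ < 1) :
    Complex.exp (MatrixLog.mlog W).trace = W.det := by
  rw [Complex.exp_eq_exp_ℂ, ← det_exp_eq_exp_trace, MatrixLog.exp_mlog hW]

/-- `tr log W ∈ 2πiℤ` for `det W = 1`, `‖W − 1‖ < 1`. [folklore] -/
theorem trace_mlog_mem_zmultiples {W : Matrix n n ℂ} (hW : ‖W - 1‖ < 1) (hdet : W.det = 1) :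
    (MatrixLog.mlog W).trace ∈ AddSubgroup.zmultiples (2 * Real.pi * I : ℂ) := by
  have h : Complex.exp (MatrixLog.mlog W).trace = 1 := by rw [cexp_trace_mlog_eq_det hW, hdet]
  obtain ⟨k, hk⟩ := Complex.exp_eq_one_iff.1 h
  rw [hk]
  exact AddSubgroup.mem_zmultiples_iff.2 ⟨k, by rw [zsmul_eq_mul]⟩

/-! ## §2  `tr log(e^X e^Y) = 0` for trace-free `X, Y`, `‖X‖ + ‖Y‖ ≤ 1/3` — no dependence on `N` -/

/-- Norm of a real multiple, `0 ≤ t`: `‖(t : ℂ)•X‖ = t‖X‖`. [folklore] -/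
theorem norm_real_smul_of_nonneg {t : ℝ} (ht : 0 ≤ t) (X : Matrix n n ℂ) : ‖(t : ℂ) • X‖ = t * ‖X‖ := by
  rw [norm_smul, Complex.norm_real, Real.norm_eq_abs, abs_of_nonneg ht]

/-- **`tr log(e^X e^Y) = 0` for trace-free `X, Y ∈ M_N(ℂ)` with `‖X‖ + ‖Y‖ ≤ 1/3`, for EVERY `N`.**  Proof: along
`W_t = e^{tX}e^{tY}`, `t ∈ [0, 1]`: `‖W_t − 1‖ ≤ 2t(‖X‖ + ‖Y‖) ≤ 2/3 < 1`, `det W_t = 1`, so `t ↦ tr log W_t` is a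
continuous map of the connected `[0, 1]` into the discrete `2πiℤ ⊂ ℂ`, hence constant, and `tr log W_0 = tr log 1 = 0`.
[folklore] -/
theorem trace_mlog_exp_mul_exp_eq_zero {X Y : Matrix n n ℂ} (hX : X.trace = 0) (hY : Y.trace = 0)
    (h : ‖X‖ + ‖Y‖ ≤ 1 / 3) : (MatrixLog.mlog (exp X * exp Y)).trace = 0 := by
  letI : NormedAlgebra ℚ (Matrix n n ℂ) := NormedAlgebra.restrictScalars ℚ ℂ _
  -- the path `W_t = e^{tX} e^{tY}`
  set W : ℝ → Matrix n n ℂ := fun t => exp ((t : ℂ) • X) * exp ((t : ℂ) • Y) with hWdef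
  have hnorm : ∀ t ∈ Set.Icc (0 : ℝ) 1, ‖W t - 1‖ < 1 := by
    intro t ht
    have hs : ‖(t : ℂ) • X‖ + ‖(t : ℂ) • Y‖ ≤ 1 / 3 := by
      rw [norm_real_smul_of_nonneg ht.1, norm_real_smul_of_nonneg ht.1, ← mul_add]
      calc t * (‖X‖ + ‖Y‖) ≤ 1 * (‖X‖ + ‖Y‖) :=
            mul_le_mul_of_nonneg_right ht.2 (add_nonneg (norm_nonneg _) (norm_nonneg _))
        _ ≤ 1 / 3 := by rw [one_mul]; exact h
    calc ‖W t - 1‖ ≤ 2 * (‖(t : ℂ) • X‖ + ‖(t : ℂ) • Y‖) := norm_expMul_sub_one_le_two_mul (by linarith)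
      _ < 1 := by linarith
  have hWc : Continuous W := by
    have hc : Continuous fun t : ℝ => (t : ℂ) := Complex.continuous_ofReal
    exact (exp_continuous.comp (hc.smul continuous_const)).mul (exp_continuous.comp (hc.smul continuous_const))
  -- `t ↦ tr log W_t` is continuous on `[0, 1]` …
  have hf : ContinuousOn (fun t : ℝ => (MatrixLog.mlog (W t)).trace) (Set.Icc 0 1) := by
    have h1 : ContinuousOn (fun t => logOnePlus (W t - 1)) (Set.Icc 0 1) :=
      continuousOn_logOnePlus_comp (hWc.sub continuous_const).continuousOn hnorm
    have htr : Continuous fun M : Matrix n n ℂ => M.trace :=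
      (Matrix.traceLinearMap n ℂ ℂ).continuous_of_finiteDimensional
    exact htr.comp_continuousOn h1
  -- … with values in the discrete set `2πiℤ`
  have hmaps : Set.MapsTo (fun t : ℝ => (MatrixLog.mlog (W t)).trace) (Set.Icc 0 1)
      (AddSubgroup.zmultiples (2 * Real.pi * I : ℂ) : Set ℂ) := by
    intro t ht
    have hdet : (W t).det = 1 :=
      det_exp_mul_exp_eq_one (by rw [Matrix.trace_smul, hX, smul_zero]) (by rw [Matrix.trace_smul, hY, smul_zero])
    exact trace_mlog_mem_zmultiples (hnorm t ht) hdet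
  have hdisc : IsDiscrete (AddSubgroup.zmultiples (2 * Real.pi * I : ℂ) : Set ℂ) :=
    SetLike.isDiscrete_iff_discreteTopology.2 inferInstance
  -- hence constant on the connected `[0, 1]`
  have hconst : (MatrixLog.mlog (W 0)).trace = (MatrixLog.mlog (W 1)).trace :=
    isPreconnected_Icc.constant_of_mapsTo hdisc hf hmaps (Set.left_mem_Icc.2 zero_le_one)
      (Set.right_mem_Icc.2 zero_le_one)
  have hW0 : W 0 = 1 := by simp [hWdef]
  have hW1 : W 1 = exp X * exp Y := by simp [hWdef]
  rw [← hW1, ← hconst, hW0, MatrixLog.mlog_one, Matrix.trace_zero]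

/-- **`𝔰𝔩(N, ℂ)` is closed under `(X, Y) ↦ log(e^X e^Y)` at the `N`-FREE radius `‖X‖ + ‖Y‖ ≤ 1/3`** (compare
`B12Membership313IILie.bchLog_mem_lie (specialLinearLogChart n)`, which needs `‖e^X e^Y − 1‖ ≤ min(1/3, 3/N)`).
[folklore] -/
theorem bchLog_mem_specialLinear [Nonempty n] {X Y : Matrix n n ℂ} (hX : X ∈ (specialLinearLogChart n).lie)
    (hY : Y ∈ (specialLinearLogChart n).lie) (h : ‖X‖ + ‖Y‖ ≤ 1 / 3) :
    bchLog X Y ∈ (specialLinearLogChart n).lie := by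
  rw [mem_specialLinearLogChart_lie] at hX hY ⊢
  rw [bchLog_eq_mlog]
  exact trace_mlog_exp_mul_exp_eq_zero hX hY h

/-! ## §3  The (ii)-clause for `G = SU(N)`, uniformly in `N` -/

/-- **Trace-free `A″ = newPot ξ 𝐀 A′`, `N`-free**: `0 ≤ ξ`, trace-free `𝐀, A′`, `ξ(‖𝐀‖ + ‖A′‖) ≤ 1/3` ⟹ `tr A″ = 0`
(compare `B12Membership313IILie.trace_newPot_eq_zero`, which needs `2ξ(‖𝐀‖ + ‖A′‖) ≤ min(1/3, 3/N)`). [folklore] -/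
theorem trace_newPot_eq_zero' {ξ : ℝ} (hξ : 0 ≤ ξ) {A A' : Matrix n n ℂ} (hA : A.trace = 0) (hA' : A'.trace = 0)
    (h : ξ * (‖A‖ + ‖A'‖) ≤ 1 / 3) : (newPot ξ A A').trace = 0 := by
  have e : ‖(I * ξ) • A‖ + ‖(I * ξ) • A'‖ = ξ * (‖A‖ + ‖A'‖) := by
    rw [norm_I_mul_smul hξ, norm_I_mul_smul hξ]; ring
  have h1 : (bchLog ((I * ξ) • A) ((I * ξ) • A')).trace = 0 := by
    rw [bchLog_eq_mlog]
    exact trace_mlog_exp_mul_exp_eq_zero (by rw [Matrix.trace_smul, hA, smul_zero])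
      (by rw [Matrix.trace_smul, hA', smul_zero]) (by rw [e]; exact h)
  show ((I * ξ)⁻¹ • bchLog ((I * ξ) • A) ((I * ξ) • A')).trace = 0
  rw [Matrix.trace_smul, h1, smul_zero]

/-- **(ii) of (1.13) for `G = SU(N)` — the clause «A′ has values in the algebra 𝐠ᶜ» (here `𝔤ᶜ = 𝔰𝔩(N, ℂ)`), UNIFORMLY IN
`N`** (operator norm), under the companion transcription's hypotheses at one bond and NOTHING else: `0 < ξ ≤ 1`, `8α₂ ≤
α₁ ≤ 1/16`, `|A′(b)| < ½α₁`, `|𝐀(b)| < α₂`, trace-free `𝐀(b)`, `A′(b)`; then `tr A″(b) = 0` for `A″ = newPot ξ 𝐀 A′`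
(indeed `ξ(‖𝐀‖ + ‖A′‖) < α₂ + ½α₁ ≤ ⅝α₁ ≤ 5/128 < 1/3`). This removes the chart-radius restriction `2α₁ ≤ min(1/3, 3/N)`
of `B12Membership313IILie.trace_newPot_eq_zero_of_condII`; the four analytic conclusions of (ii) are
`B12Membership313II.condII_expMul` specialised to matrices (apply at `b` and at `b₁`).
[cite: Balaban1987RG1, p. 272 (sentence before (3.14)) with (1.13) p. 262 and p. 252 — the clause «A′ has values in the
algebra 𝐠ᶜ» of condition (ii) for `G = SU(N)`, restriction independent of `N`; proof, restriction and model of `𝔤ᶜ`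
ours] -/
theorem trace_newPot_eq_zero_of_condII' {ξ α₁ α₂ : ℝ} (hξ : 0 < ξ) (hξ1 : ξ ≤ 1) (hres : 8 * α₂ ≤ α₁)
    (hα₁ : 16 * α₁ ≤ 1) {A A' : Matrix n n ℂ} (hAl : A.trace = 0) (hA'l : A'.trace = 0)
    (hA' : ‖A'‖ < 1 / 2 * α₁) (hA : ‖A‖ < α₂) : (newPot ξ A A').trace = 0 := by
  have nA0 := norm_nonneg A
  have nA'0 := norm_nonneg A'
  have hs : ξ * (‖A‖ + ‖A'‖) ≤ ‖A‖ + ‖A'‖ := mul_le_of_le_one_left (add_nonneg nA0 nA'0) hξ1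
  exact trace_newPot_eq_zero' hξ.le hAl hA'l (by linarith)

end Literature.MathematicalPhysics.QuantumFieldTheory.Balaban1983to89.B12Membership313IISL
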